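import Summits.QuantumFields.YangMills.Theorems.BalabanUVNodesN15PerCubeGreenSopGauged
import Summits.QuantumFields.YangMills.Theorems.BalabanUVNodesN15PerCubeGreenSopLocalModel
import Summits.QuantumFields.YangMills.Theorems.BalabanUVNodesN15CurvedGluingLocalGauges
import Summits.QuantumFields.YangMills.Theorems.BalabanUVNodesN15CovariantLandauSopRowCTUniform
import Summits.QuantumFields.YangMills.Theorems.BalabanUVNodesN15CovariantLandauProjection
import HarnessLib

/-!
# N15 = NE2, road (c) — PROGRAMME (PC), (PC-B): `(Q′G′²Q′ᵀ)⁻¹(U)` DECAYS, UNIFORMLY IN THE SCALE, FOR `U` IN BAŁABAN's PER-CUBE CLASS — the per-cube expansion (3.95)–(3.96) with flat local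
# models in the cubes' gauges, glued by dag-n15-w2's FILE 46: ★★★★ `hasMaj_cSop_inv_of_reg335BigBox` (dag-n15-c g28, n15-c∕299e)

Cell `pub-ymgap`, seat `pub-ymgap-dag-n15-c` (generation g28; R134 (a), s1; HUMAN RULING D-0062).  `bears_on: R4∕N15 · K3⁸ SpineGivenEndpointR13SepCoPHV (stmt-QuantumFields-27366)`;
filed `--kind proof --supports stmt-QuantumFields-27366 --as helper` — COUNT-NEUTRAL.  0 `def`, 0 `sorry`.  Imports n15-c∕299d `…PerCubeGreenSopGauged` (`exists_gaugedSop_rows`), n15-c∕299c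
`…PerCubeGreenSopLocalModel` (`localModel_hloc∕cutRow∕commRow∕defectRow`, `hasMaj_commOp_blockLipschitz₀`), dag-n15-w2 FILE 46 `…CurvedGluingLocalGauges` (`hasMaj_glued_of_localGauges`,
`glued_inverse_of_localGauges`), n15-c∕222b `…CovariantLandauSopRowCTUniform` (`flatSopRow_ct_uniform`), n15-c∕214 `…CovariantLandauProjection` (`isUnit_cSop`), n15-c∕262's cover geometry.
Nothing in the tree is modified.

WHY ((PC-B), [B9] (3.95)–(3.96) p.411: «β′G′²β′*C₀ = I − R, C₀ = Σ_□ h_□C_□h_□ … (β′G′²β′*)⁻¹ = C₀(I − R)⁻¹»; Cor. 3.8 p.410; (3.25) p.394 `R = I − G′Q′*(Q′G′²Q′*)⁻¹Q′G′`).  The Landau letter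
of road (c) contains `(Q′G′²Q′ᵀ)⁻¹(U)`; for `U` in the PRINTED per-cube class (3.35) (no global small gauge) its decay must be assembled cube by cube.  THIS FILE does it in the model: at every
cube `□` of n15-c∕262's cover, in the cube's unitary gauge `u_□` (class (3.35) on the walk-locality box of `□`, n15-c∕299b), `S(U) = 𝕎_□ᵀS(U^{u_□})𝕎_□` (n15-c∕198), the flat local parametrix
`S(𝟙)⁻¹M_{χ_□}` (n15-c∕222b: `S(𝟙)⁻¹ ≤ C_S n^{d+1}e^{−δd}`) has cut rows, commutator rows `[S(U^{u_□}), M_{h_□}]S(𝟙)⁻¹M_χ = O(w⁻¹)` (block-Lipschitz partition, n15-c∕299a′'s row of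
`S(U^{u_□})` at scale `n^{−(d+1)}`) and defect `M_h(S(U^{u_□}) − S(𝟙))S(𝟙)⁻¹M_χ = O(Σ(r_V) + e^{−δw})` (n15-c∕299a's closeness at scale `n^{−(d+1)}`, `d_Z ≥ w` on `supp h_□`) — n15-c∕299c∕299d
— so FILE 46 glues a two-sided inverse of `S(U)` with row `≤ 2N_ov|ι|²C_S n^{d+1}c_r·e^{−δ′d}` once `w = L^m ≥ w₀` and the (3.35) letters are `≤ R₀`; by `isUnit_cSop` it IS `mulVecLin S(U)⁻¹`.

HONEST FRAMING ∕ LIMITS.  MODEL carriers (n15-c∕262's cover of the doubled unit torus `2Lw`, `L ≥ 11`): the class (3.35) is ASKED on the walk-locality box of every cube (side `(L+10)w`,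
more than half the torus — the model's cube regions have side `Lw`); all smallness displayed (`r_V`-letters and `σ(r_V)` against `R₀`, `w ≥ w₀`); no operator of record estimated; [B9] cited
for SHAPES ∕ MECHANISM, NOT the printed statements.  NE2⁺ NOT PRINTED, NOT proved; N15 of record untouched; K3⁸ OPEN; counts UNMOVED.  Restate-immune (no Theses import).
-/

noncomputable section

open scoped BigOperators Matrix Matrix.Norms.L2Operator

namespace Summit.QuantumFields.YangMills.BalabanUVNodes.N15.Gluing

open Real
open Literature.MathematicalPhysics.QuantumFieldTheory.Balaban1983to89
open Literature.MathematicalPhysics.QuantumFieldTheory.Balaban1983to89.B5Prop11Plancherel (Tor fine unitVec)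
open Literature.MathematicalPhysics.QuantumFieldTheory.Balaban1983to89.B5Block118 (up bpt)
open Literature.MathematicalPhysics.QuantumFieldTheory.Balaban1983to89.B11SectG (BlockNorm HasMaj RowSum)
open Literature.MathematicalPhysics.QuantumFieldTheory.Balaban1983to89.B6RandomWalk (Triangle254)
open Literature.MathematicalPhysics.QuantumFieldTheory.Balaban1983to89.B6Prop26Gluing (mulOp mulOp_apply ind ind_nonneg)
open Literature.MathematicalPhysics.QuantumFieldTheory.Balaban1983to89.B6UnitTorusCarrier (unitTorusGeo triangle254_unitTorusGeo rowSum_unitTorusGeo unitTorusGeo_dist_nonneg unitTorusGeo_dist_self unitTorusGeo_dist_symm)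
open Literature.MathematicalPhysics.QuantumFieldTheory.Balaban1983to89.B9Eq3117Current (gaugeTr)
open Literature.MathematicalPhysics.QuantumFieldTheory.Balaban1983to89.B9Eq39Adjoint (covD fluct)
open Summit.QuantumFields.YangMills.BalabanUVNodes.N15.CovLandau (cSop flatSopRow_ct_uniform isUnit_cSop)
open Summit.QuantumFields.YangMills.BalabanUVNodes.N15.BackgroundModel (kappa_ofBlocks)
open Literature.MathematicalPhysics.QuantumFieldTheory.King1986 (aK aK_pos aK_le aK_ge)
open Literature.MathematicalPhysics.QuantumFieldTheory.King1986.Torus (blockOf)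
open Literature.Barriers.QuantumFields (traceForm)
open Summit.QuantumFields.YangMills.BalabanUVNodes.N15.MatrixSpecies (mmulOp coordMat basisConst liftBlk)
open Summit.QuantumFields.YangMills.BalabanUVNodes.N15.TwoGrid (cubeBlocks abs_chiCube_le_one)
open Summit.QuantumFields.YangMills.BalabanUVNodes.N15.CurvedSpecies (hasMaj_glued_of_localGauges glued_inverse_of_localGauges)

variable {d : ℕ}

section Inverse

variable {L : ℕ} [NeZero L]

/-- a right inverse of `mulVecLin S` for an invertible matrix `S` IS `mulVecLin S⁻¹`. [folklore] -/
theorem eq_mulVecLin_inv_of_comp_eq_id {m : Type} [Fintype m] [DecidableEq m] {S : Matrix m m ℝ} (hS : IsUnit S) {G : (m → ℝ) →ₗ[ℝ] (m → ℝ)}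
    (hG : Matrix.mulVecLin S ∘ₗ G = LinearMap.id) : G = Matrix.mulVecLin S⁻¹ := by
  have hdet : IsUnit S.det := (Matrix.isUnit_iff_isUnit_det _).mp hS
  have hleft : Matrix.mulVecLin S⁻¹ ∘ₗ Matrix.mulVecLin S = LinearMap.id := by rw [← Matrix.mulVecLin_mul, Matrix.nonsing_inv_mul _ hdet, Matrix.mulVecLin_one]
  calc G = (Matrix.mulVecLin S⁻¹ ∘ₗ Matrix.mulVecLin S) ∘ₗ G := by rw [hleft, LinearMap.id_comp]
    _ = Matrix.mulVecLin S⁻¹ := by rw [LinearMap.comp_assoc, hG, LinearMap.comp_id]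

set_option maxHeartbeats 400000 in
/-- ★★★★ **`(Q′G′²Q′ᵀ)⁻¹(U)` DECAYS FOR `U` IN THE PER-CUBE CLASS, UNIFORMLY IN `k`.**  There are `δ, w₀, R₀, B > 0` such that for all `m, k ≥ 1` with `L^m ≥ w₀`, every isometric
chart `e`, every `U(m)`-valued site bond field `U` on the `L^k`-fine doubled torus carrying, on the walk-locality box `{x | B(x) ∈ c(Lw + 3w − 1 − m₀, □) + [0, (L+10)w)}` of EVERY cube `□`, a
unitary gauge `u_□` and a potential `A_□` with `U^{u_□} = e^{iηA_□}`, `|A_□| < Cξ⁻¹`, `|∇^ηA_□| < Cξ⁻²` (Bałaban's (3.35) on that box), and (3.35)-letters `r_V` with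
`r_V(1+|J⊕J|) + a₀|ι|(|ι|σ² + 2σ) ≤ R₀`, `σ = (1 + r_VL^{−k})^{(d+1)L^k} − 1 ≤ R₀`:
`mulVecLin (cSop (cvT e U) a_K)⁻¹ ≤ B·(L^k)^{d+1}·e^{−δ|y−y′|_T}` on the coarse coloured scalars (and `cSop (cvT e U) a_K` is invertible, n15-c∕214).  MODEL carriers; the SHAPE ∕ MECHANISM of
[B9] (3.95)–(3.96), NOT the printed statement. [cite: Balaban1985BackgroundPropagators, (3.95)–(3.96) p.411, Cor. 3.8 p.410, (3.87) p.409, (3.34)–(3.35) p.396, (3.25) p.394 (shapes ∕ mechanism); Balaban1984PropagatorsII, (2.91) p.239, (2.133)–(2.136) p.247] -/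
theorem hasMaj_cSop_inv_of_reg335BigBox (hL : Odd L ∧ 1 < L) (hL11 : 11 ≤ L) {a₀ : ℝ} (ha₀ : 0 < a₀) (ι : Type) [Fintype ι] [DecidableEq ι] :
    ∃ δ w₀ R₀ B : ℝ, 0 < δ ∧ 0 < R₀ ∧ 0 < B ∧
      ∀ (mv kk : ℕ), 1 ≤ kk → w₀ ≤ ((L ^ mv : ℕ) : ℝ) →
      ∀ {mm : Type} [Fintype mm] [DecidableEq mm] [Nonempty mm] (e : Matrix mm mm ℂ ≃L[ℝ] (ι → ℝ)), (∀ A B : Matrix mm mm ℂ, traceForm A B = e A ⬝ᵥ e B) →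
      ∀ (U : Fin (d + 1) → ScX d L mv kk hL → (Matrix mm mm ℂ)ˣ), (∀ μ x, (U μ x : Matrix mm mm ℂ) ∈ Matrix.unitaryGroup mm ℂ) →
      ∀ (ξ C : ℝ), 0 < ξ → 0 < C →
        (∀ k : Fin (d + 1) → ZMod (2 * L), ∃ (u : ScX d L mv kk hL → (Matrix mm mm ℂ)ˣ) (A : Fin (d + 1) → ScX d L mv kk hL → Matrix mm mm ℂ),
          (∀ x, (u x : Matrix mm mm ℂ) ∈ Matrix.unitaryGroup mm ℂ) ∧
          (∀ μ, ∀ z ∈ {x : ScX d L mv kk hL | blockOf (L ^ kk) (cvM d L mv kk hL) x ∈ cubeBlocks (cvM d L mv kk hL) (coverCorner (cvM d L mv kk hL) (L ^ mv) L (L * L ^ mv + 3 * L ^ mv - 1 - coverMargin L mv) k) (L * L ^ mv + 10 * L ^ mv)},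
              gaugeTr (scShift d L mv kk hL) u U μ z = fluct ((((L ^ kk : ℕ) : ℝ))⁻¹) A μ z) ∧
          (∀ μ, ∀ z ∈ {x : ScX d L mv kk hL | blockOf (L ^ kk) (cvM d L mv kk hL) x ∈ cubeBlocks (cvM d L mv kk hL) (coverCorner (cvM d L mv kk hL) (L ^ mv) L (L * L ^ mv + 3 * L ^ mv - 1 - coverMargin L mv) k) (L * L ^ mv + 10 * L ^ mv)},
              ‖A μ z‖ < C * ξ⁻¹) ∧
          (∀ μ ν, ∀ z ∈ {x : ScX d L mv kk hL | blockOf (L ^ kk) (cvM d L mv kk hL) x ∈ cubeBlocks (cvM d L mv kk hL) (coverCorner (cvM d L mv kk hL) (L ^ mv) L (L * L ^ mv + 3 * L ^ mv - 1 - coverMargin L mv) k) (L * L ^ mv + 10 * L ^ mv)},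
              ‖((↑((((L ^ kk : ℕ) : ℝ))⁻¹) : ℂ)⁻¹) • covD (scShift d L mv kk hL) (fun _ _ => (1 : (Matrix mm mm ℂ)ˣ)) μ (A ν) z‖ < C * (ξ ^ 2)⁻¹)) →
      ∀ (rV : ℝ), 0 ≤ rV →
        Fintype.card ι * (@basisConst ι _ (Matrix mm mm ℂ) Matrix.frobeniusNormedAddCommGroup Matrix.frobeniusNormedSpace e * (2 * Real.sqrt (Fintype.card mm)) * (Real.sqrt (Fintype.card mm) * ((C / ξ) * Real.exp (((((L ^ kk : ℕ) : ℝ))⁻¹) * (C / ξ))))) ≤ rV →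
        Fintype.card ι * (Fintype.card (Fin (d + 1)) * (Fintype.card ι * (@basisConst ι _ (Matrix mm mm ℂ) Matrix.frobeniusNormedAddCommGroup Matrix.frobeniusNormedSpace e * (2 * Real.sqrt (Fintype.card mm)) * (Real.sqrt (Fintype.card mm) * ((C / ξ) * Real.exp (((((L ^ kk : ℕ) : ℝ))⁻¹) * (C / ξ))))) ^ 2 + @basisConst ι _ (Matrix mm mm ℂ) Matrix.frobeniusNormedAddCommGroup Matrix.frobeniusNormedSpace e * (2 * Real.sqrt (Fintype.card mm)) * (Real.sqrt (Fintype.card mm) * ((C / ξ ^ 2) * Real.exp (((((L ^ kk : ℕ) : ℝ))⁻¹) * (C / ξ)))))) ≤ rV →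
        rV * (1 + Fintype.card (Fin (d + 1) ⊕ Fin (d + 1))) + a₀ * (Fintype.card ι * (Fintype.card ι * ((1 + rV * ((((L ^ kk : ℕ) : ℝ))⁻¹)) ^ ((d + 1) * L ^ kk) - 1) ^ 2 + 2 * ((1 + rV * ((((L ^ kk : ℕ) : ℝ))⁻¹)) ^ ((d + 1) * L ^ kk) - 1))) ≤ R₀ →
        ((1 + rV * ((((L ^ kk : ℕ) : ℝ))⁻¹)) ^ ((d + 1) * L ^ kk) - 1) ≤ R₀ →
        HasMaj (BlockNorm.ofBlocks (unitTorusGeo L kk (cvM d L mv kk hL)) (liftBlk (fun y : Tor (cvM d L mv kk hL) => y) ι)) (BlockNorm.ofBlocks (unitTorusGeo L kk (cvM d L mv kk hL)) (liftBlk (fun y : Tor (cvM d L mv kk hL) => y) ι))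
            (Matrix.mulVecLin (cSop (cvM d L mv kk hL) (L ^ kk) (cvT e (fun μ x => (U μ x : Matrix mm mm ℂ))) (aK a₀ (L : ℝ) kk * (((L ^ kk : ℕ) : ℝ)) ^ (d + 1)))⁻¹)
          (fun y y' => B * (((L ^ kk : ℕ) : ℝ)) ^ (d + 1) * Real.exp (-(δ * (unitTorusGeo L kk (cvM d L mv kk hL)).dist y y'))) := by
  classical
  have hL7 : 7 ≤ L := by omega
  have hL1r : (1 : ℝ) < (L : ℝ) := by exact_mod_cast hL.2
  -- King's masses lie in `[a₀∕2, a₀]`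
  have haKlo : ∀ K : ℕ, 1 ≤ K → a₀ / 2 ≤ aK a₀ (L : ℝ) K := fun K hK => by
    have h1 := aK_ge ha₀ hL1r hK (a := a₀)
    have hL2 : (2 : ℝ) ≤ (L : ℝ) := by exact_mod_cast (show 2 ≤ L by omega)
    have hL4 : (4 : ℝ) ≤ (L : ℝ) ^ 2 := by nlinarith
    have hinv : ((L : ℝ) ^ 2)⁻¹ ≤ 1 / 4 := by rw [one_div]; exact inv_anti₀ (by norm_num) hL4
    have h2 := mul_le_mul_of_nonneg_left hinv ha₀.le
    nlinarith
  -- the inputs: the per-cube gauged data (n15-c∕299d) and the flat row (n15-c∕222b) on King's mass interval `[a₀∕2, a₀]`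
  obtain ⟨δg, wg, Rg, Bg, hδg, hRg, hBg, HG⟩ := exists_gaugedSop_rows (d := d) hL hL11 ha₀ ι
  obtain ⟨CS, δS, hCS, hδS, HS⟩ := flatSopRow_ct_uniform (d := d) L (a₁ := a₀ / 2) (a₂ := a₀) (by positivity) (by linarith)
  -- rates
  set δ₀ : ℝ := min δg δS with hδ₀def
  have hδ₀ : 0 < δ₀ := lt_min hδg hδS
  have hδ₀g : δ₀ ≤ δg := min_le_left _ _
  have hδ₀S : δ₀ ≤ δS := min_le_right _ _
  set σr : ℝ := δ₀ / 8 with hσrdef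
  have hσr : 0 < σr := by positivity
  set cr : ℝ := B4Sect5Proof.latticeConst (d + 1) σr with hcrdef
  have hcr0 : 0 ≤ cr := B4Sect5Proof.latticeConst_nonneg (d + 1) hσr.le
  -- constants: overlap, the two defect budgets
  set Nov : ℝ := (((2 * L) ^ (d + 1) : ℕ) : ℝ) with hNovdef
  have hNov0 : 0 ≤ Nov := by positivity
  set P : ℝ := π * (d + 1) * (Real.exp 1 * (δ₀ / 4))⁻¹ * Bg * CS * cr with hPdef
  have hP0 : 0 ≤ P := by positivity
  set Q : ℝ := Bg * CS * cr with hQdef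
  have hQ0 : 0 ≤ Q := by positivity
  set Kt : ℝ := Nov * ((Fintype.card ι : ℝ) ^ 2) * cr with hKtdef
  have hKt0 : 0 ≤ Kt := by positivity
  refine ⟨3 * δ₀ / 8, max wg (max 2 (4 * Kt * (P + Q + Q * δg⁻¹) + 1)), min Rg (1 / (8 * Kt * Q + 1)), 2 * Nov * ((Fintype.card ι : ℝ) ^ 2 * (CS * 1)) * cr + 1, by positivity,
    lt_min hRg (by positivity), by positivity, fun mv kk hk hw₀ => ?_⟩
  intro mm _ _ _ e he U hU ξ C hξ hC hbig rV hrV hrA hrC hRle hσV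
  have hwg : wg ≤ ((L ^ mv : ℕ) : ℝ) := (le_max_left _ _).trans hw₀
  have hW2R : (2 : ℝ) ≤ ((L ^ mv : ℕ) : ℝ) := ((le_max_left _ _).trans (le_max_right _ _)).trans hw₀
  have hW2 : 2 ≤ L ^ mv := by exact_mod_cast hW2R
  have hwK : 4 * Kt * (P + Q + Q * δg⁻¹) + 1 ≤ ((L ^ mv : ℕ) : ℝ) := ((le_max_right _ _).trans (le_max_right _ _)).trans hw₀
  have hwpos : (0 : ℝ) < ((L ^ mv : ℕ) : ℝ) := by linarith
  have hRg' := hRle.trans (min_le_left _ _)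
  have hRq : rV * (1 + Fintype.card (Fin (d + 1) ⊕ Fin (d + 1))) + a₀ * (Fintype.card ι * (Fintype.card ι * ((1 + rV * ((((L ^ kk : ℕ) : ℝ))⁻¹)) ^ ((d + 1) * L ^ kk) - 1) ^ 2 + 2 * ((1 + rV * ((((L ^ kk : ℕ) : ℝ))⁻¹)) ^ ((d + 1) * L ^ kk) - 1))) ≤ 1 / (8 * Kt * Q + 1) :=
    hRle.trans (min_le_right _ _)
  have hσq : ((1 + rV * ((((L ^ kk : ℕ) : ℝ))⁻¹)) ^ ((d + 1) * L ^ kk) - 1) ≤ 1 / (8 * Kt * Q + 1) := hσV.trans (min_le_right _ _)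
  have hnpos : (0 : ℝ) < ((L ^ kk : ℕ) : ℝ) ^ (d + 1) := by positivity
  have ha' : 0 < aK a₀ (L : ℝ) kk * (((L ^ kk : ℕ) : ℝ)) ^ (d + 1) := mul_pos (aK_pos ha₀ hL1r hk) hnpos
  have hU' : ∀ μ x, ((U μ x : Matrix mm mm ℂ))ᴴ * (U μ x : Matrix mm mm ℂ) = 1 := fun μ x => Matrix.mem_unitaryGroup_iff'.mp (hU μ x)
  -- geometry
  have htri : Triangle254 (unitTorusGeo L kk (cvM d L mv kk hL)) := triangle254_unitTorusGeo L kk _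
  have hd : ∀ a b : Tor (cvM d L mv kk hL), 0 ≤ (unitTorusGeo L kk (cvM d L mv kk hL)).dist a b := unitTorusGeo_dist_nonneg L kk _
  have hd0 : ∀ y : Tor (cvM d L mv kk hL), (unitTorusGeo L kk (cvM d L mv kk hL)).dist y y = 0 := unitTorusGeo_dist_self L kk _
  have hsymm : ∀ y y' : Tor (cvM d L mv kk hL), (unitTorusGeo L kk (cvM d L mv kk hL)).dist y y' = (unitTorusGeo L kk (cvM d L mv kk hL)).dist y' y := unitTorusGeo_dist_symm L kk _
  have hrow : RowSum (unitTorusGeo L kk (cvM d L mv kk hL)) σr cr := by rw [hcrdef]; exact rowSum_unitTorusGeo L kk _ hσr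
  have hκ : (BlockNorm.ofBlocks (unitTorusGeo L kk (cvM d L mv kk hL)) (liftBlk (fun y : Tor (cvM d L mv kk hL) => y) ι)).κ = 1 := kappa_ofBlocks _
  have hM : ∀ ν, cvM d L mv kk hL ν = 2 * L * L ^ mv := MP_succ_eq L mv kk hL
  have hw : 0 < L ^ mv := by omega
  have hm₁ : 2 * L ^ mv ≤ coverMargin L mv := two_mul_le_coverMargin hL7 mv
  have hfitI : coverMargin L mv - 2 * L ^ mv + (6 * L ^ mv + 1) ≤ L * L ^ mv := coverMargin_inner_fit hL7 hW2
  have hS0 : L * L ^ mv ≤ 2 * L * L ^ mv := by rw [mul_assoc]; omega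
  have hK2 : 2 ≤ 2 * L := by omega
  have hlo : (2 : ℝ) * ((L ^ mv : ℕ) : ℝ) ≤ ((2 * L ^ mv : ℕ) : ℝ) := by push_cast; exact le_rfl
  have hhi : ((2 * L ^ mv : ℕ) : ℝ) + ((L ^ mv : ℕ) : ℝ) + (2 + 1) * ((L ^ mv : ℕ) : ℝ) + 1 ≤ ((6 * L ^ mv + 1 : ℕ) : ℝ) := by push_cast; linarith only []
  have hS6 : 6 * L ^ mv + 1 ≤ 2 * L * L ^ mv := by
    have h7 : 7 * L ^ mv ≤ L * L ^ mv := Nat.mul_le_mul_right _ hL7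
    have e2 : 2 * L * L ^ mv = 2 * (L * L ^ mv) := by ring
    rw [e2]; omega
  have hwin : ∀ (k : Fin (d + 1) → ZMod (2 * L)) (x : ScX d L mv kk hL), scH d L mv kk hL k x ≠ 0 → scChi d L mv kk hL k x = 1 := fun k x hx =>
    scChi_lift_eq_one_of_near_bbox (ι := Unit) 2 hM hw hlo hhi hS6 0 k (x, ())
      ⟨(x, ()), Or.inl rfl, fun ν => (abs_cenRep_lt_one_of_hcube_ne_zero (K := 2 * L) (ξ := scXi d L mv kk hL) hx ν).trans (by norm_num)⟩
  have hχS : ∀ (k : Fin (d + 1) → ZMod (2 * L)) (p : Tor (cvM d L mv kk hL) × ι), scChi d L mv kk hL k (up (L ^ kk) (cvM d L mv kk hL) p.1) ≠ 0 →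
      liftBlk (fun y : Tor (cvM d L mv kk hL) => y) ι p ∈ cvSk d L mv kk hL k := fun k p hp => by
    have h := blockOf_mem_cubeBlocks_of_inner_ne_zero hM hm₁ hfitI hS0 (x := (up (L ^ kk) (cvM d L mv kk hL) p.1, (0 : Fin (d + 1)))) hp
    rw [blockOf_up] at h
    exact Finset.mem_coe.mpr h
  -- the per-cube data and the flat row
  have HGk := HG mv kk hk hwg e he U hU ξ C hξ hC hbig rV hrV hrA hrC hRg'
  choose W A dZ hWo hWo' hdZ0 hconj hrowA hclose hmarg using HGk
  have hS1 := HS (aK a₀ (L : ℝ) kk) (haKlo kk hk) (aK_le ha₀ hL1r hk) (cvM d L mv kk hL) (L ^ kk) kk ι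
  have hS1ρ : HasMaj (BlockNorm.ofBlocks (unitTorusGeo L kk (cvM d L mv kk hL)) (liftBlk (fun y : Tor (cvM d L mv kk hL) => y) ι)) (BlockNorm.ofBlocks (unitTorusGeo L kk (cvM d L mv kk hL)) (liftBlk (fun y : Tor (cvM d L mv kk hL) => y) ι))
      (Matrix.mulVecLin (cSop (cvM d L mv kk hL) (L ^ kk) (fun (_ : Fin (d + 1)) (_ : ScX d L mv kk hL) => (1 : Matrix ι ι ℝ)) (aK a₀ (L : ℝ) kk * (((L ^ kk : ℕ) : ℝ)) ^ (d + 1)))⁻¹)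
      (fun y y' => CS * (((L ^ kk : ℕ) : ℝ)) ^ (d + 1) * Real.exp (-(δS * (unitTorusGeo L kk (cvM d L mv kk hL)).dist y y'))) := hS1
  have hunit1 : IsUnit (cSop (cvM d L mv kk hL) (L ^ kk) (fun (_ : Fin (d + 1)) (_ : ScX d L mv kk hL) => (1 : Matrix ι ι ℝ)) (aK a₀ (L : ℝ) kk * (((L ^ kk : ℕ) : ℝ)) ^ (d + 1))) :=
    isUnit_cSop (cvM d L mv kk hL) (L ^ kk) (fun _ _ => isUnit_one) ha'
  have hinv1 : Matrix.mulVecLin (cSop (cvM d L mv kk hL) (L ^ kk) (fun (_ : Fin (d + 1)) (_ : ScX d L mv kk hL) => (1 : Matrix ι ι ℝ)) (aK a₀ (L : ℝ) kk * (((L ^ kk : ℕ) : ℝ)) ^ (d + 1))) ∘ₗ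
      Matrix.mulVecLin (cSop (cvM d L mv kk hL) (L ^ kk) (fun (_ : Fin (d + 1)) (_ : ScX d L mv kk hL) => (1 : Matrix ι ι ℝ)) (aK a₀ (L : ℝ) kk * (((L ^ kk : ℕ) : ℝ)) ^ (d + 1)))⁻¹ = LinearMap.id := by
    rw [← Matrix.mulVecLin_mul, Matrix.mul_nonsing_inv _ ((Matrix.isUnit_iff_isUnit_det _).mp hunit1), Matrix.mulVecLin_one]
  -- rate weakenings
  have hrate : ∀ ⦃c ρ ρ' : ℝ⦄, 0 ≤ c → ρ' ≤ ρ → ∀ y y' : Tor (cvM d L mv kk hL), c * Real.exp (-(ρ * (unitTorusGeo L kk (cvM d L mv kk hL)).dist y y')) ≤ c * Real.exp (-(ρ' * (unitTorusGeo L kk (cvM d L mv kk hL)).dist y y')) :=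
    fun c ρ ρ' hc hρ y y' => mul_le_mul_of_nonneg_left (Real.exp_le_exp.mpr (by nlinarith only [hd y y', hρ])) hc
  -- FILE 46's four per-cube inputs
  have hGc' : ∀ k, HasMaj (BlockNorm.ofBlocks (unitTorusGeo L kk (cvM d L mv kk hL)) (liftBlk (fun y : Tor (cvM d L mv kk hL) => y) ι)) (BlockNorm.ofBlocks (unitTorusGeo L kk (cvM d L mv kk hL)) (liftBlk (fun y : Tor (cvM d L mv kk hL) => y) ι))
      (mulOp (fun p : Tor (cvM d L mv kk hL) × ι => scChi d L mv kk hL k (up (L ^ kk) (cvM d L mv kk hL) p.1)) ∘ₗ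
        (Matrix.mulVecLin (cSop (cvM d L mv kk hL) (L ^ kk) (fun (_ : Fin (d + 1)) (_ : ScX d L mv kk hL) => (1 : Matrix ι ι ℝ)) (aK a₀ (L : ℝ) kk * (((L ^ kk : ℕ) : ℝ)) ^ (d + 1)))⁻¹ ∘ₗ
          mulOp (fun p : Tor (cvM d L mv kk hL) × ι => scChi d L mv kk hL k (up (L ^ kk) (cvM d L mv kk hL) p.1))))
      (fun y y' => ind (cvSk d L mv kk hL k) y * ind (cvSk d L mv kk hL k) y' * (CS * (((L ^ kk : ℕ) : ℝ)) ^ (d + 1) * Real.exp (-((δ₀ / 2) * (unitTorusGeo L kk (cvM d L mv kk hL)).dist y y')))) := fun k =>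
    localModel_cutRow (g := unitTorusGeo L kk (cvM d L mv kk hL)) (liftBlk (fun y : Tor (cvM d L mv kk hL) => y) ι) (S := cvSk d L mv kk hL k) (C := CS * (((L ^ kk : ℕ) : ℝ)) ^ (d + 1)) (δ := δ₀ / 2) (by positivity) (fun p => abs_chiCube_le_one _ _) (hχS k)
      (hS1ρ.mono (hrate (c := CS * (((L ^ kk : ℕ) : ℝ)) ^ (d + 1)) (ρ := δS) (ρ' := δ₀ / 2) (by positivity) (by linarith)))
  have hK' : ∀ k, HasMaj (BlockNorm.ofBlocks (unitTorusGeo L kk (cvM d L mv kk hL)) (liftBlk (fun y : Tor (cvM d L mv kk hL) => y) ι)) (BlockNorm.ofBlocks (unitTorusGeo L kk (cvM d L mv kk hL)) (liftBlk (fun y : Tor (cvM d L mv kk hL) => y) ι))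
      (commOp (A k)
          (fun p : Tor (cvM d L mv kk hL) × ι => scH d L mv kk hL k (up (L ^ kk) (cvM d L mv kk hL) p.1)) ∘ₗ
        (Matrix.mulVecLin (cSop (cvM d L mv kk hL) (L ^ kk) (fun (_ : Fin (d + 1)) (_ : ScX d L mv kk hL) => (1 : Matrix ι ι ℝ)) (aK a₀ (L : ℝ) kk * (((L ^ kk : ℕ) : ℝ)) ^ (d + 1)))⁻¹ ∘ₗ
          mulOp (fun p : Tor (cvM d L mv kk hL) × ι => scChi d L mv kk hL k (up (L ^ kk) (cvM d L mv kk hL) p.1))))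
      (fun y y' => ind (cvSk d L mv kk hL k) y' * ((BlockNorm.ofBlocks (unitTorusGeo L kk (cvM d L mv kk hL)) (liftBlk (fun y : Tor (cvM d L mv kk hL) => y) ι)).κ * (π * (d + 1) / ((L ^ mv : ℕ) : ℝ) * (Real.exp 1 * (δ₀ / 4))⁻¹ * (Bg * ((((L ^ kk : ℕ) : ℝ)) ^ (d + 1))⁻¹)) * (CS * (((L ^ kk : ℕ) : ℝ)) ^ (d + 1)) * cr *
        Real.exp (-((δ₀ / 2) * (unitTorusGeo L kk (cvM d L mv kk hL)).dist y y')))) := fun k => by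
    have hA0 := (hrowA k).mono (hrate (c := Bg * ((((L ^ kk : ℕ) : ℝ)) ^ (d + 1))⁻¹) (ρ := δg) (ρ' := δ₀) (by positivity) hδ₀g)
    have hcomm := hasMaj_commOp_blockLipschitz₀ (g := unitTorusGeo L kk (cvM d L mv kk hL)) (liftBlk (fun y : Tor (cvM d L mv kk hL) => y) ι) (h := fun p : Tor (cvM d L mv kk hL) × ι => scH d L mv kk hL k (up (L ^ kk) (cvM d L mv kk hL) p.1))
      (hb := fun y => coverHb (cvM d L mv kk hL) (L ^ kk) (L ^ mv) L k y) (ε := δ₀ / 4) (ℓ := π * (d + 1) / ((L ^ mv : ℕ) : ℝ)) (by positivity) (by positivity) (by positivity) hd hsymm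
      (fun y y' => abs_coverHb_sub_le hM hw k y y') (fun p => scH_up k p.1) hA0
    exact localModel_commRow (g := unitTorusGeo L kk (cvM d L mv kk hL)) (liftBlk (fun y : Tor (cvM d L mv kk hL) => y) ι) (S := cvSk d L mv kk hL k) htri hd hrow (by positivity) (by positivity) (by positivity) (by linarith) (by linarith)
      (fun p => abs_chiCube_le_one _ _) (hχS k) hcomm hS1ρ
  have hE' : ∀ k, HasMaj (BlockNorm.ofBlocks (unitTorusGeo L kk (cvM d L mv kk hL)) (liftBlk (fun y : Tor (cvM d L mv kk hL) => y) ι)) (BlockNorm.ofBlocks (unitTorusGeo L kk (cvM d L mv kk hL)) (liftBlk (fun y : Tor (cvM d L mv kk hL) => y) ι))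
      (mulOp (fun p : Tor (cvM d L mv kk hL) × ι => scH d L mv kk hL k (up (L ^ kk) (cvM d L mv kk hL) p.1)) ∘ₗ
        ((A k - Matrix.mulVecLin (cSop (cvM d L mv kk hL) (L ^ kk) (fun (_ : Fin (d + 1)) (_ : ScX d L mv kk hL) => (1 : Matrix ι ι ℝ)) (aK a₀ (L : ℝ) kk * (((L ^ kk : ℕ) : ℝ)) ^ (d + 1)))) ∘ₗ
          (Matrix.mulVecLin (cSop (cvM d L mv kk hL) (L ^ kk) (fun (_ : Fin (d + 1)) (_ : ScX d L mv kk hL) => (1 : Matrix ι ι ℝ)) (aK a₀ (L : ℝ) kk * (((L ^ kk : ℕ) : ℝ)) ^ (d + 1)))⁻¹ ∘ₗ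
            mulOp (fun p : Tor (cvM d L mv kk hL) × ι => scChi d L mv kk hL k (up (L ^ kk) (cvM d L mv kk hL) p.1)))))
      (fun y y' => ind (cvSk d L mv kk hL k) y * (((rV * (1 + Fintype.card (Fin (d + 1) ⊕ Fin (d + 1))) + aK a₀ (L : ℝ) kk * (Fintype.card ι * (Fintype.card ι * ((1 + rV * ((((L ^ kk : ℕ) : ℝ))⁻¹)) ^ ((d + 1) * L ^ kk) - 1) ^ 2 + 2 * ((1 + rV * ((((L ^ kk : ℕ) : ℝ))⁻¹)) ^ ((d + 1) * L ^ kk) - 1))) +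
          ((1 + rV * ((((L ^ kk : ℕ) : ℝ))⁻¹)) ^ ((d + 1) * L ^ kk) - 1) + (((L ^ mv : ℕ) : ℝ))⁻¹ + 1 * Real.exp (-(δg * ((L ^ mv : ℕ) : ℝ)))) *
          ((BlockNorm.ofBlocks (unitTorusGeo L kk (cvM d L mv kk hL)) (liftBlk (fun y : Tor (cvM d L mv kk hL) => y) ι)).κ * (Bg * ((((L ^ kk : ℕ) : ℝ)) ^ (d + 1))⁻¹) * (CS * (((L ^ kk : ℕ) : ℝ)) ^ (d + 1)) * cr)) *
        Real.exp (-((δ₀ / 2) * (unitTorusGeo L kk (cvM d L mv kk hL)).dist y y')))) := fun k => by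
    have hSIG0 : 0 ≤ ((1 + rV * ((((L ^ kk : ℕ) : ℝ))⁻¹)) ^ ((d + 1) * L ^ kk) - 1) := by
      have := one_le_pow₀ (M₀ := ℝ) (a := 1 + rV * ((((L ^ kk : ℕ) : ℝ))⁻¹)) (le_add_of_nonneg_right (by positivity)) (n := (d + 1) * L ^ kk); linarith only [this]
    have haK := aK_pos ha₀ hL1r hk
    refine localModel_defectRow (g := unitTorusGeo L kk (cvM d L mv kk hL)) (liftBlk (fun y : Tor (cvM d L mv kk hL) => y) ι) (S := cvSk d L mv kk hL k) htri hd hrow hcr0 ?_ zero_le_one hδg.le (by positivity) (by positivity) (by positivity) (by linarith) (by linarith)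
      (fun p => abs_hcube_le_one (2 * L) (scXi d L mv kk hL) k _) (fun p hp => ⟨hχS k p (by rw [hwin k _ hp]; exact one_ne_zero), hmarg k p.1 hp⟩) (fun p => abs_chiCube_le_one _ _) (hclose k) hS1ρ
    exact add_nonneg (add_nonneg (add_nonneg (mul_nonneg hrV (by positivity)) (mul_nonneg haK.le (mul_nonneg (Nat.cast_nonneg _) (add_nonneg (by positivity) (mul_nonneg zero_le_two hSIG0))))) hSIG0) (by positivity)
  have hloc' : ∀ k, mulOp (fun p : Tor (cvM d L mv kk hL) × ι => scH d L mv kk hL k (up (L ^ kk) (cvM d L mv kk hL) p.1)) ∘ₗ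
      (mmulOp (W k) ∘ₗ Matrix.mulVecLin (cSop (cvM d L mv kk hL) (L ^ kk) (cvT e (fun μ x => (U μ x : Matrix mm mm ℂ))) (aK a₀ (L : ℝ) kk * (((L ^ kk : ℕ) : ℝ)) ^ (d + 1))) ∘ₗ mmulOp (fun x => (W k x)ᵀ)) ∘ₗ
        (Matrix.mulVecLin (cSop (cvM d L mv kk hL) (L ^ kk) (fun (_ : Fin (d + 1)) (_ : ScX d L mv kk hL) => (1 : Matrix ι ι ℝ)) (aK a₀ (L : ℝ) kk * (((L ^ kk : ℕ) : ℝ)) ^ (d + 1)))⁻¹ ∘ₗ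
          mulOp (fun p : Tor (cvM d L mv kk hL) × ι => scChi d L mv kk hL k (up (L ^ kk) (cvM d L mv kk hL) p.1))) =
      mulOp (fun p : Tor (cvM d L mv kk hL) × ι => scH d L mv kk hL k (up (L ^ kk) (cvM d L mv kk hL) p.1)) +
        mulOp (fun p : Tor (cvM d L mv kk hL) × ι => scH d L mv kk hL k (up (L ^ kk) (cvM d L mv kk hL) p.1)) ∘ₗ
          (((mmulOp (W k) ∘ₗ Matrix.mulVecLin (cSop (cvM d L mv kk hL) (L ^ kk) (cvT e (fun μ x => (U μ x : Matrix mm mm ℂ))) (aK a₀ (L : ℝ) kk * (((L ^ kk : ℕ) : ℝ)) ^ (d + 1))) ∘ₗ mmulOp (fun x => (W k x)ᵀ)) - Matrix.mulVecLin (cSop (cvM d L mv kk hL) (L ^ kk) (fun (_ : Fin (d + 1)) (_ : ScX d L mv kk hL) => (1 : Matrix ι ι ℝ)) (aK a₀ (L : ℝ) kk * (((L ^ kk : ℕ) : ℝ)) ^ (d + 1)))) ∘ₗ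
            (Matrix.mulVecLin (cSop (cvM d L mv kk hL) (L ^ kk) (fun (_ : Fin (d + 1)) (_ : ScX d L mv kk hL) => (1 : Matrix ι ι ℝ)) (aK a₀ (L : ℝ) kk * (((L ^ kk : ℕ) : ℝ)) ^ (d + 1)))⁻¹ ∘ₗ
              mulOp (fun p : Tor (cvM d L mv kk hL) × ι => scChi d L mv kk hL k (up (L ^ kk) (cvM d L mv kk hL) p.1)))) := fun k => by
    have h := localModel_hloc (A := A k) (h := fun p : Tor (cvM d L mv kk hL) × ι => scH d L mv kk hL k (up (L ^ kk) (cvM d L mv kk hL) p.1))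
      (χ := fun p : Tor (cvM d L mv kk hL) × ι => scChi d L mv kk hL k (up (L ^ kk) (cvM d L mv kk hL) p.1)) hinv1 (mulOp_comp_mulOp_of_support fun p hp => hwin k _ hp)
    rw [← hconj k] at h
    exact h
  -- the partition bookkeeping
  have h236 : ∀ p : Tor (cvM d L mv kk hL) × ι, ∑ k, (fun p : Tor (cvM d L mv kk hL) × ι => scH d L mv kk hL k (up (L ^ kk) (cvM d L mv kk hL) p.1)) p ^ 2 = 1 :=
    fun p => sum_hcube_sq (2 * L) (scXi d L mv kk hL) hK2 _
  have hh : ∀ k (p : Tor (cvM d L mv kk hL) × ι), |(fun p : Tor (cvM d L mv kk hL) × ι => scH d L mv kk hL k (up (L ^ kk) (cvM d L mv kk hL) p.1)) p| ≤ 1 :=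
    fun k p => abs_hcube_le_one (2 * L) (scXi d L mv kk hL) k _
  have hN : ∀ a, ∑ k, ind (g := unitTorusGeo L kk (cvM d L mv kk hL)) (cvSk d L mv kk hL k) a ≤ Nov :=
    fun y => sum_ind_cubeBlocks_le (M := cvM d L mv kk hL) (w := L ^ mv) (q := L) (m₀ := coverMargin L mv) L kk y
  have hcut : ∀ k, mulOp (fun p : Tor (cvM d L mv kk hL) × ι => scH d L mv kk hL k (up (L ^ kk) (cvM d L mv kk hL) p.1)) ∘ₗ mulOp (fun p : Tor (cvM d L mv kk hL) × ι => scChi d L mv kk hL k (up (L ^ kk) (cvM d L mv kk hL) p.1)) =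
      mulOp (fun p : Tor (cvM d L mv kk hL) × ι => scH d L mv kk hL k (up (L ^ kk) (cvM d L mv kk hL) p.1)) := fun k => mulOp_comp_mulOp_of_support fun p hp => hwin k _ hp
  -- the smallness `q ≤ 1∕2`
  have hnn : ((((L ^ kk : ℕ) : ℝ)) ^ (d + 1))⁻¹ * (((L ^ kk : ℕ) : ℝ)) ^ (d + 1) = 1 := inv_mul_cancel₀ hnpos.ne'
  set θ₀ : ℝ := π * (d + 1) / ((L ^ mv : ℕ) : ℝ) * (Real.exp 1 * (δ₀ / 4))⁻¹ * (Bg * ((((L ^ kk : ℕ) : ℝ)) ^ (d + 1))⁻¹) * (CS * (((L ^ kk : ℕ) : ℝ)) ^ (d + 1)) * cr with hθ₀def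
  set εd : ℝ := ((rV * (1 + Fintype.card (Fin (d + 1) ⊕ Fin (d + 1))) + aK a₀ (L : ℝ) kk * (Fintype.card ι * (Fintype.card ι * ((1 + rV * ((((L ^ kk : ℕ) : ℝ))⁻¹)) ^ ((d + 1) * L ^ kk) - 1) ^ 2 + 2 * ((1 + rV * ((((L ^ kk : ℕ) : ℝ))⁻¹)) ^ ((d + 1) * L ^ kk) - 1))) +
      ((1 + rV * ((((L ^ kk : ℕ) : ℝ))⁻¹)) ^ ((d + 1) * L ^ kk) - 1) + (((L ^ mv : ℕ) : ℝ))⁻¹ + 1 * Real.exp (-(δg * ((L ^ mv : ℕ) : ℝ)))) *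
      (1 * (Bg * ((((L ^ kk : ℕ) : ℝ)) ^ (d + 1))⁻¹) * (CS * (((L ^ kk : ℕ) : ℝ)) ^ (d + 1)) * cr)) with hεddef
  have hθ₀eq : θ₀ = P * (((L ^ mv : ℕ) : ℝ))⁻¹ := by
    rw [hθ₀def, hPdef]
    field_simp
  have hSIG0 : 0 ≤ ((1 + rV * ((((L ^ kk : ℕ) : ℝ))⁻¹)) ^ ((d + 1) * L ^ kk) - 1) := by
    have := one_le_pow₀ (M₀ := ℝ) (a := 1 + rV * ((((L ^ kk : ℕ) : ℝ))⁻¹)) (le_add_of_nonneg_right (by positivity)) (n := (d + 1) * L ^ kk); linarith only [this]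
  have hSumle : (rV * (1 + Fintype.card (Fin (d + 1) ⊕ Fin (d + 1))) + aK a₀ (L : ℝ) kk * (Fintype.card ι * (Fintype.card ι * ((1 + rV * ((((L ^ kk : ℕ) : ℝ))⁻¹)) ^ ((d + 1) * L ^ kk) - 1) ^ 2 + 2 * ((1 + rV * ((((L ^ kk : ℕ) : ℝ))⁻¹)) ^ ((d + 1) * L ^ kk) - 1))) +
      ((1 + rV * ((((L ^ kk : ℕ) : ℝ))⁻¹)) ^ ((d + 1) * L ^ kk) - 1) + (((L ^ mv : ℕ) : ℝ))⁻¹ + 1 * Real.exp (-(δg * ((L ^ mv : ℕ) : ℝ)))) ≤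
      2 * (1 / (8 * Kt * Q + 1)) + (1 + δg⁻¹) * (((L ^ mv : ℕ) : ℝ))⁻¹ := by
    have h1 : aK a₀ (L : ℝ) kk * (Fintype.card ι * (Fintype.card ι * ((1 + rV * ((((L ^ kk : ℕ) : ℝ))⁻¹)) ^ ((d + 1) * L ^ kk) - 1) ^ 2 + 2 * ((1 + rV * ((((L ^ kk : ℕ) : ℝ))⁻¹)) ^ ((d + 1) * L ^ kk) - 1))) ≤
        a₀ * (Fintype.card ι * (Fintype.card ι * ((1 + rV * ((((L ^ kk : ℕ) : ℝ))⁻¹)) ^ ((d + 1) * L ^ kk) - 1) ^ 2 + 2 * ((1 + rV * ((((L ^ kk : ℕ) : ℝ))⁻¹)) ^ ((d + 1) * L ^ kk) - 1))) :=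
      mul_le_mul_of_nonneg_right (aK_le ha₀ hL1r hk) (mul_nonneg (Nat.cast_nonneg _) (add_nonneg (by positivity) (mul_nonneg zero_le_two hSIG0)))
    have h2 : Real.exp (-(δg * ((L ^ mv : ℕ) : ℝ))) ≤ δg⁻¹ * (((L ^ mv : ℕ) : ℝ))⁻¹ := by
      -- `e^{−t} ≤ t⁻¹` for `t > 0`
      have ht := mul_pos hδg hwpos
      rw [← mul_inv, Real.exp_neg]
      exact inv_anti₀ ht ((by linarith : δg * ((L ^ mv : ℕ) : ℝ) ≤ δg * ((L ^ mv : ℕ) : ℝ) + 1).trans (Real.add_one_le_exp _))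
    linarith [h1, h2, hRq, hσq]
  have hθε : θ₀ + εd ≤ (P + Q + Q * δg⁻¹) * (((L ^ mv : ℕ) : ℝ))⁻¹ + 2 * Q * (1 / (8 * Kt * Q + 1)) := by
    have hεd : εd = (rV * (1 + Fintype.card (Fin (d + 1) ⊕ Fin (d + 1))) + aK a₀ (L : ℝ) kk * (Fintype.card ι * (Fintype.card ι * ((1 + rV * ((((L ^ kk : ℕ) : ℝ))⁻¹)) ^ ((d + 1) * L ^ kk) - 1) ^ 2 + 2 * ((1 + rV * ((((L ^ kk : ℕ) : ℝ))⁻¹)) ^ ((d + 1) * L ^ kk) - 1))) +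
        ((1 + rV * ((((L ^ kk : ℕ) : ℝ))⁻¹)) ^ ((d + 1) * L ^ kk) - 1) + (((L ^ mv : ℕ) : ℝ))⁻¹ + 1 * Real.exp (-(δg * ((L ^ mv : ℕ) : ℝ)))) * Q := by
      rw [hεddef, hQdef]
      have : 1 * (Bg * ((((L ^ kk : ℕ) : ℝ)) ^ (d + 1))⁻¹) * (CS * (((L ^ kk : ℕ) : ℝ)) ^ (d + 1)) * cr = Bg * CS * cr := by
        calc 1 * (Bg * ((((L ^ kk : ℕ) : ℝ)) ^ (d + 1))⁻¹) * (CS * (((L ^ kk : ℕ) : ℝ)) ^ (d + 1)) * cr = Bg * CS * cr * (((((L ^ kk : ℕ) : ℝ)) ^ (d + 1))⁻¹ * (((L ^ kk : ℕ) : ℝ)) ^ (d + 1)) := by ring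
          _ = Bg * CS * cr := by rw [hnn, mul_one]
      rw [this]
    rw [hθ₀eq, hεd]
    have hm := mul_le_mul_of_nonneg_right hSumle hQ0
    linarith [hm]
  have hq12 : Nov * ((Fintype.card ι : ℝ) ^ 2 * θ₀ + (Fintype.card ι : ℝ) ^ 2 * εd) * cr ≤ 1 / 2 := by
    have hKt : Nov * ((Fintype.card ι : ℝ) ^ 2 * θ₀ + (Fintype.card ι : ℝ) ^ 2 * εd) * cr = Kt * (θ₀ + εd) := by rw [hKtdef]; ring
    rw [hKt]
    have hw1 : Kt * ((P + Q + Q * δg⁻¹) * (((L ^ mv : ℕ) : ℝ))⁻¹) ≤ 1 / 4 := by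
      rw [show Kt * ((P + Q + Q * δg⁻¹) * (((L ^ mv : ℕ) : ℝ))⁻¹) = (Kt * (P + Q + Q * δg⁻¹)) / ((L ^ mv : ℕ) : ℝ) by rw [div_eq_mul_inv]; ring]
      rw [div_le_iff₀ hwpos]
      linarith [hwK, mul_nonneg hKt0 (add_nonneg (add_nonneg hP0 hQ0) (mul_nonneg hQ0 (inv_nonneg.2 hδg.le)))]
    have hw2 : Kt * (2 * Q * (1 / (8 * Kt * Q + 1))) ≤ 1 / 4 := by
      rw [show Kt * (2 * Q * (1 / (8 * Kt * Q + 1))) = (2 * (Kt * Q)) / (8 * Kt * Q + 1) by field_simp]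
      rw [div_le_iff₀ (by positivity)]
      linarith [mul_nonneg hKt0 hQ0]
    have hθ0 : 0 ≤ θ₀ := by rw [hθ₀def]; positivity
    linarith [mul_le_mul_of_nonneg_left hθε hKt0, hw1, hw2]
  have hq : Nov * ((Fintype.card ι : ℝ) ^ 2 * θ₀ + (Fintype.card ι : ℝ) ^ 2 * εd) * cr < 1 := hq12.trans_lt (by norm_num)
  -- FILE 46
  have hθ0 : 0 ≤ θ₀ := by rw [hθ₀def]; positivity
  have hεd0 : 0 ≤ εd := by
    rw [hεddef]
    have haK := aK_pos ha₀ hL1r hk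
    exact mul_nonneg (add_nonneg (add_nonneg (add_nonneg (add_nonneg (mul_nonneg hrV (by positivity)) (mul_nonneg haK.le (mul_nonneg (Nat.cast_nonneg _) (add_nonneg (by positivity) (mul_nonneg zero_le_two hSIG0))))) hSIG0) (by positivity)) (by positivity)) (by positivity)
  have hK'' : ∀ k, HasMaj (BlockNorm.ofBlocks (unitTorusGeo L kk (cvM d L mv kk hL)) (liftBlk (fun y : Tor (cvM d L mv kk hL) => y) ι)) (BlockNorm.ofBlocks (unitTorusGeo L kk (cvM d L mv kk hL)) (liftBlk (fun y : Tor (cvM d L mv kk hL) => y) ι))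
      (commOp (mmulOp (W k) ∘ₗ Matrix.mulVecLin (cSop (cvM d L mv kk hL) (L ^ kk) (cvT e (fun μ x => (U μ x : Matrix mm mm ℂ))) (aK a₀ (L : ℝ) kk * (((L ^ kk : ℕ) : ℝ)) ^ (d + 1))) ∘ₗ mmulOp (fun x => (W k x)ᵀ))
          (fun p : Tor (cvM d L mv kk hL) × ι => scH d L mv kk hL k (up (L ^ kk) (cvM d L mv kk hL) p.1)) ∘ₗ
        (Matrix.mulVecLin (cSop (cvM d L mv kk hL) (L ^ kk) (fun (_ : Fin (d + 1)) (_ : ScX d L mv kk hL) => (1 : Matrix ι ι ℝ)) (aK a₀ (L : ℝ) kk * (((L ^ kk : ℕ) : ℝ)) ^ (d + 1)))⁻¹ ∘ₗ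
          mulOp (fun p : Tor (cvM d L mv kk hL) × ι => scChi d L mv kk hL k (up (L ^ kk) (cvM d L mv kk hL) p.1))))
      (fun y y' => ind (cvSk d L mv kk hL k) y' * (θ₀ * Real.exp (-((δ₀ / 2) * (unitTorusGeo L kk (cvM d L mv kk hL)).dist y y')))) := fun k => by
    have h := hK' k
    rw [← hconj k] at h
    exact h.mono fun y y' => le_of_eq (by rw [hκ, hθ₀def]; ring)
  have hE'' : ∀ k, HasMaj (BlockNorm.ofBlocks (unitTorusGeo L kk (cvM d L mv kk hL)) (liftBlk (fun y : Tor (cvM d L mv kk hL) => y) ι)) (BlockNorm.ofBlocks (unitTorusGeo L kk (cvM d L mv kk hL)) (liftBlk (fun y : Tor (cvM d L mv kk hL) => y) ι))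
      (mulOp (fun p : Tor (cvM d L mv kk hL) × ι => scH d L mv kk hL k (up (L ^ kk) (cvM d L mv kk hL) p.1)) ∘ₗ
        (((mmulOp (W k) ∘ₗ Matrix.mulVecLin (cSop (cvM d L mv kk hL) (L ^ kk) (cvT e (fun μ x => (U μ x : Matrix mm mm ℂ))) (aK a₀ (L : ℝ) kk * (((L ^ kk : ℕ) : ℝ)) ^ (d + 1))) ∘ₗ mmulOp (fun x => (W k x)ᵀ)) - Matrix.mulVecLin (cSop (cvM d L mv kk hL) (L ^ kk) (fun (_ : Fin (d + 1)) (_ : ScX d L mv kk hL) => (1 : Matrix ι ι ℝ)) (aK a₀ (L : ℝ) kk * (((L ^ kk : ℕ) : ℝ)) ^ (d + 1)))) ∘ₗ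
          (Matrix.mulVecLin (cSop (cvM d L mv kk hL) (L ^ kk) (fun (_ : Fin (d + 1)) (_ : ScX d L mv kk hL) => (1 : Matrix ι ι ℝ)) (aK a₀ (L : ℝ) kk * (((L ^ kk : ℕ) : ℝ)) ^ (d + 1)))⁻¹ ∘ₗ
            mulOp (fun p : Tor (cvM d L mv kk hL) × ι => scChi d L mv kk hL k (up (L ^ kk) (cvM d L mv kk hL) p.1)))))
      (fun y y' => ind (cvSk d L mv kk hL k) y * (εd * Real.exp (-((δ₀ / 2) * (unitTorusGeo L kk (cvM d L mv kk hL)).dist y y')))) := fun k => by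
    have h := hE' k
    rw [← hconj k] at h
    exact h.mono fun y y' => le_of_eq (by rw [hκ, hεddef])
  have hq' : Nov * (((Fintype.card ι : ℝ)) ^ 2 * θ₀ + ((Fintype.card ι : ℝ)) ^ 2 * εd) * cr < 1 := hq
  obtain ⟨-, hright⟩ := glued_inverse_of_localGauges (fun y : Tor (cvM d L mv kk hL) => y) (fun k => cvSk d L mv kk hL k) W
    (Matrix.mulVecLin (cSop (cvM d L mv kk hL) (L ^ kk) (cvT e (fun μ x => (U μ x : Matrix mm mm ℂ))) (aK a₀ (L : ℝ) kk * (((L ^ kk : ℕ) : ℝ)) ^ (d + 1))))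
    (fun k y => scH d L mv kk hL k (up (L ^ kk) (cvM d L mv kk hL) y))
    (fun k => Matrix.mulVecLin (cSop (cvM d L mv kk hL) (L ^ kk) (fun (_ : Fin (d + 1)) (_ : ScX d L mv kk hL) => (1 : Matrix ι ι ℝ)) (aK a₀ (L : ℝ) kk * (((L ^ kk : ℕ) : ℝ)) ^ (d + 1)))⁻¹ ∘ₗ
      mulOp (fun p : Tor (cvM d L mv kk hL) × ι => scChi d L mv kk hL k (up (L ^ kk) (cvM d L mv kk hL) p.1)))
    (fun k => mulOp (fun p : Tor (cvM d L mv kk hL) × ι => scH d L mv kk hL k (up (L ^ kk) (cvM d L mv kk hL) p.1)) ∘ₗ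
      (((mmulOp (W k) ∘ₗ Matrix.mulVecLin (cSop (cvM d L mv kk hL) (L ^ kk) (cvT e (fun μ x => (U μ x : Matrix mm mm ℂ))) (aK a₀ (L : ℝ) kk * (((L ^ kk : ℕ) : ℝ)) ^ (d + 1))) ∘ₗ mmulOp (fun x => (W k x)ᵀ)) - Matrix.mulVecLin (cSop (cvM d L mv kk hL) (L ^ kk) (fun (_ : Fin (d + 1)) (_ : ScX d L mv kk hL) => (1 : Matrix ι ι ℝ)) (aK a₀ (L : ℝ) kk * (((L ^ kk : ℕ) : ℝ)) ^ (d + 1)))) ∘ₗ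
        (Matrix.mulVecLin (cSop (cvM d L mv kk hL) (L ^ kk) (fun (_ : Fin (d + 1)) (_ : ScX d L mv kk hL) => (1 : Matrix ι ι ℝ)) (aK a₀ (L : ℝ) kk * (((L ^ kk : ℕ) : ℝ)) ^ (d + 1)))⁻¹ ∘ₗ
          mulOp (fun p : Tor (cvM d L mv kk hL) × ι => scChi d L mv kk hL k (up (L ^ kk) (cvM d L mv kk hL) p.1)))))
    hd hrow hWo' hWo hθ0 hεd0 hNov0 (show σr ≤ δ₀ / 2 by rw [hσrdef]; linarith) h236 hh hN hloc' hK'' hE'' hq'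
  have hdec := hasMaj_glued_of_localGauges (fun y : Tor (cvM d L mv kk hL) => y) (fun k => cvSk d L mv kk hL k) W
    (Matrix.mulVecLin (cSop (cvM d L mv kk hL) (L ^ kk) (cvT e (fun μ x => (U μ x : Matrix mm mm ℂ))) (aK a₀ (L : ℝ) kk * (((L ^ kk : ℕ) : ℝ)) ^ (d + 1))))
    (fun k y => scH d L mv kk hL k (up (L ^ kk) (cvM d L mv kk hL) y)) (fun k y => scChi d L mv kk hL k (up (L ^ kk) (cvM d L mv kk hL) y))
    (fun k => Matrix.mulVecLin (cSop (cvM d L mv kk hL) (L ^ kk) (fun (_ : Fin (d + 1)) (_ : ScX d L mv kk hL) => (1 : Matrix ι ι ℝ)) (aK a₀ (L : ℝ) kk * (((L ^ kk : ℕ) : ℝ)) ^ (d + 1)))⁻¹ ∘ₗ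
      mulOp (fun p : Tor (cvM d L mv kk hL) × ι => scChi d L mv kk hL k (up (L ^ kk) (cvM d L mv kk hL) p.1)))
    (fun k => mulOp (fun p : Tor (cvM d L mv kk hL) × ι => scH d L mv kk hL k (up (L ^ kk) (cvM d L mv kk hL) p.1)) ∘ₗ
      (((mmulOp (W k) ∘ₗ Matrix.mulVecLin (cSop (cvM d L mv kk hL) (L ^ kk) (cvT e (fun μ x => (U μ x : Matrix mm mm ℂ))) (aK a₀ (L : ℝ) kk * (((L ^ kk : ℕ) : ℝ)) ^ (d + 1))) ∘ₗ mmulOp (fun x => (W k x)ᵀ)) - Matrix.mulVecLin (cSop (cvM d L mv kk hL) (L ^ kk) (fun (_ : Fin (d + 1)) (_ : ScX d L mv kk hL) => (1 : Matrix ι ι ℝ)) (aK a₀ (L : ℝ) kk * (((L ^ kk : ℕ) : ℝ)) ^ (d + 1)))) ∘ₗ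
        (Matrix.mulVecLin (cSop (cvM d L mv kk hL) (L ^ kk) (fun (_ : Fin (d + 1)) (_ : ScX d L mv kk hL) => (1 : Matrix ι ι ℝ)) (aK a₀ (L : ℝ) kk * (((L ^ kk : ℕ) : ℝ)) ^ (d + 1)))⁻¹ ∘ₗ
          mulOp (fun p : Tor (cvM d L mv kk hL) × ι => scChi d L mv kk hL k (up (L ^ kk) (cvM d L mv kk hL) p.1)))))
    htri hd hd0 hrow hσr.le hWo' hWo (β := CS * (((L ^ kk : ℕ) : ℝ)) ^ (d + 1)) (by positivity) hθ0 hεd0 hNov0 (show 2 * σr ≤ δ₀ / 2 by rw [hσrdef]; linarith) hcut hh hN hGc' hK'' hE'' hq'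
  -- `𝒢 = mulVecLin S(U)⁻¹` and the final constant
  have hunitU : IsUnit (cSop (cvM d L mv kk hL) (L ^ kk) (cvT e (fun μ x => (U μ x : Matrix mm mm ℂ))) (aK a₀ (L : ℝ) kk * (((L ^ kk : ℕ) : ℝ)) ^ (d + 1))) :=
    isUnit_cSop (cvM d L mv kk hL) (L ^ kk) (isUnit_cvT ι e he (fun μ x => (U μ x : Matrix mm mm ℂ)) hU') ha'
  rw [eq_mulVecLin_inv_of_comp_eq_id hunitU hright] at hdec
  refine hdec.mono fun y y' => ?_
  have hq0 : 0 ≤ Nov * ((Fintype.card ι : ℝ) ^ 2 * θ₀ + (Fintype.card ι : ℝ) ^ 2 * εd) * cr := by positivity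
  have hinvle : (1 - Nov * ((Fintype.card ι : ℝ) ^ 2 * θ₀ + (Fintype.card ι : ℝ) ^ 2 * εd) * cr)⁻¹ ≤ 2 := by
    rw [inv_le_comm₀ (by linarith) (by norm_num)]; linarith
  have hexp : Real.exp (-((δ₀ / 2 - σr) * (unitTorusGeo L kk (cvM d L mv kk hL)).dist y y')) = Real.exp (-(3 * δ₀ / 8 * (unitTorusGeo L kk (cvM d L mv kk hL)).dist y y')) := by
    rw [hσrdef]; ring_nf
  rw [hexp]
  have hE := Real.exp_nonneg (-(3 * δ₀ / 8 * (unitTorusGeo L kk (cvM d L mv kk hL)).dist y y'))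
  have hX0 : 0 ≤ Nov * ((Fintype.card ι : ℝ) ^ 2 * (CS * (((L ^ kk : ℕ) : ℝ)) ^ (d + 1))) * cr := by positivity
  calc Nov * ((Fintype.card ι : ℝ) ^ 2 * (CS * (((L ^ kk : ℕ) : ℝ)) ^ (d + 1))) * (1 - Nov * ((Fintype.card ι : ℝ) ^ 2 * θ₀ + (Fintype.card ι : ℝ) ^ 2 * εd) * cr)⁻¹ * cr * Real.exp (-(3 * δ₀ / 8 * (unitTorusGeo L kk (cvM d L mv kk hL)).dist y y'))
      = (1 - Nov * ((Fintype.card ι : ℝ) ^ 2 * θ₀ + (Fintype.card ι : ℝ) ^ 2 * εd) * cr)⁻¹ * (Nov * ((Fintype.card ι : ℝ) ^ 2 * (CS * (((L ^ kk : ℕ) : ℝ)) ^ (d + 1))) * cr * Real.exp (-(3 * δ₀ / 8 * (unitTorusGeo L kk (cvM d L mv kk hL)).dist y y'))) := by ring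
    _ ≤ 2 * (Nov * ((Fintype.card ι : ℝ) ^ 2 * (CS * (((L ^ kk : ℕ) : ℝ)) ^ (d + 1))) * cr * Real.exp (-(3 * δ₀ / 8 * (unitTorusGeo L kk (cvM d L mv kk hL)).dist y y'))) :=
        mul_le_mul_of_nonneg_right hinvle (mul_nonneg hX0 hE)
    _ ≤ (2 * Nov * ((Fintype.card ι : ℝ) ^ 2 * (CS * 1)) * cr + 1) * (((L ^ kk : ℕ) : ℝ)) ^ (d + 1) * Real.exp (-(3 * δ₀ / 8 * (unitTorusGeo L kk (cvM d L mv kk hL)).dist y y')) := by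
        linarith [hE, hnpos, mul_nonneg hnpos.le hE, hX0]

end Inverse

end Summit.QuantumFields.YangMills.BalabanUVNodes.N15.Gluing

end
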